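import Mathlib.Geometry.Manifold.MFDeriv.Tangent
import Literature.Geometry.Kaehler.ComplexTorusForms
import HarnessLib

/-!
# The universal covering of a complex torus; forms on the torus as periodic forms

Companion of `Literature/Geometry/Kaehler/ComplexTorus.lean`, `ComplexTorusMaps.lean`,
`ComplexTorusForms.lean`. For the complex torus `X = E/Φ(ℤ^ι)` (`ComplexTorus Φ`):

* `ComplexTorus.cover Φ : E → X`, the covering map `π = proj ∘ Φ⁻¹` (Lange–Birkenhake (1992),
  Lemma 1.1.3 (a): "the natural map `π : V → X` may be considered as the universal covering
  map"), its lattice periodicity (`cover_add_latticeVec`), the *exact* formula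
  `chart Φ a (π z) = z - Φ(n)` for the charts (`chart_cover`), and its calculus as a map from
  the model space `E` (a manifold over itself) to `X`: `C^n` over `𝕜 ∈ {ℝ, ℂ}` with derivative
  the identity everywhere (`contMDiff_cover`, `hasMFDerivAt_cover`, `mfderiv_cover`); the
  inverse extended charts of `X` *are* `π` (`extChartAt_symm_eq_cover`) and the charts have
  derivative the identity (`mfderiv_extChartAt_self`);
* **forms on `X` = lattice-periodic forms on `E`** (Lange–Birkenhake (1992), §1.1.4: forms on
  `X` are identified with `Λ`-periodic forms on `V` via `π^*`): `ComplexTorus.liftForm Φ α`,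
  the periodic field `z ↦ α (π z)` (`= π^* α`, `liftForm_eq_pullback`), which is *literally*
  every chart representative of `α` (`inChart_eq_liftForm`), so that smoothness of `α` is
  smoothness of its lift (`isSmoothForm_iff_contDiff_liftForm`) and the manifold exterior
  derivative lifts to Mathlib's `extDeriv` with **no smoothness hypothesis**
  (`liftForm_mextDeriv : liftForm (dα) = extDeriv (liftForm α)`); conversely a periodic field
  descends (`ComplexTorus.descendForm`, `liftForm_descendForm`, `descendForm_liftForm`), and
  invariant forms lift to constants (`liftForm_constForm`).

This reduces the de Rham calculus of `X` to vector calculus of periodic functions on `E`.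

## Not here

The resulting description of `H^k_dR(X)` (Lange–Birkenhake (1992), Prop. 1.1.20): non-exactness
of invariant forms and averaging are the next files.

## References

* H. Lange, Ch. Birkenhake, *Complex Abelian Varieties*, Grundlehren 302 (1992), Lemma 1.1.3,
  §1.1.4. [LangeBirkenhake1992]
-/

noncomputable section

open scoped Manifold ContDiff Topology
open Bundle Set Filter

namespace Literature.Geometry.Kaehler

namespace ComplexTorus

variable {ι : Type*} {E : Type*} [NormedAddCommGroup E] [NormedSpace ℂ E] (Φ : (ι → ℝ) ≃L[ℝ] E)

/-! ### The covering map -/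

/-- **The universal covering map** `π : E → E/Φ(ℤ^ι)`, `π = proj ∘ Φ⁻¹` (Lange–Birkenhake
(1992), Lemma 1.1.3 (a)). [cite: LangeBirkenhake1992, Lemma 1.1.3] -/
def cover (z : E) : ComplexTorus Φ := proj Φ (Φ.symm z)

/-- Unfolding of `cover`. [folklore] -/
theorem cover_apply (z : E) : cover Φ z = proj Φ (Φ.symm z) := rfl

/-- `π (Φ x) = proj x`. [folklore] -/
@[simp] theorem cover_apply_apply (x : ι → ℝ) : cover Φ (Φ x) = proj Φ x := by
  rw [cover_apply, ContinuousLinearEquiv.symm_apply_apply]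

/-- The covering map is continuous. [folklore] -/
theorem continuous_cover : Continuous (cover Φ) :=
  (continuous_proj Φ).comp Φ.symm.continuous

/-- The lattice vector `Φ(n)`, `n ∈ ℤ^ι`. [folklore] -/
def latticeVec (n : ι → ℤ) : E := Φ (fun i ↦ (n i : ℝ))

/-- **The covering map is lattice periodic**: `π (z + Φ n) = π z` for `n ∈ ℤ^ι`.
[cite: LangeBirkenhake1992, Lemma 1.1.3] -/
@[simp] theorem cover_add_latticeVec (z : E) (n : ι → ℤ) :
    cover Φ (z + latticeVec Φ n) = cover Φ z := by
  rw [cover_apply, cover_apply, latticeVec, map_add, ContinuousLinearEquiv.symm_apply_apply]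
  funext i
  have hn : (((n i : ℝ)) : AddCircle (1 : ℝ)) = 0 :=
    (AddCircle.coe_eq_zero_iff (1 : ℝ)).2 ⟨n i, by simp⟩
  simp only [proj_apply, Pi.add_apply, AddCircle.coe_add, hn, add_zero]

/-- `π (z - Φ n) = π z` for `n ∈ ℤ^ι`. [folklore] -/
@[simp] theorem cover_sub_latticeVec (z : E) (n : ι → ℤ) :
    cover Φ (z - latticeVec Φ n) = cover Φ z := by
  conv_rhs => rw [← sub_add_cancel z (latticeVec Φ n)]
  rw [cover_add_latticeVec]

/-- The integer vector moving `Φ⁻¹ z` into the box with corner `a`. [folklore] -/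
def boxIndex (a : ι → ℝ) (z : E) : ι → ℤ := fun i ↦ toIcoDiv zero_lt_one (a i) (Φ.symm z i)

variable [Fintype ι]

/-- The inverse of every chart of the torus is (a restriction of) the covering map. [folklore] -/
theorem chart_symm_eq_cover (a : ι → ℝ) : ((chart Φ a).symm : E → ComplexTorus Φ) = cover Φ :=
  rfl

/-- The inverse extended chart at every point is the covering map (`𝕜 ∈ {ℝ, ℂ}`). [folklore] -/
theorem extChartAt_symm_eq_cover {𝕜 : Type*} [NontriviallyNormedField 𝕜] [NormedSpace 𝕜 E]
    (x : ComplexTorus Φ) : ((extChartAt 𝓘(𝕜, E) x).symm : E → ComplexTorus Φ) = cover Φ := by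
  rw [extChartAt_coe_symm]
  rfl

/-- The covering map is onto: `x = π (φₓ x)` for the preferred chart `φₓ` at `x`. [folklore] -/
theorem cover_extChartAt_self {𝕜 : Type*} [NontriviallyNormedField 𝕜] [NormedSpace 𝕜 E]
    (x : ComplexTorus Φ) : cover Φ (extChartAt 𝓘(𝕜, E) x x) = x := by
  rw [← extChartAt_symm_eq_cover Φ (𝕜 := 𝕜) x]
  exact extChartAt_to_inv x

/-- The covering map is surjective. [cite: LangeBirkenhake1992, Lemma 1.1.3] -/
theorem cover_surjective : Function.Surjective (cover Φ) :=
  fun x ↦ ⟨extChartAt 𝓘(ℝ, E) x x, cover_extChartAt_self Φ x⟩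

/-- **The charts on the image of the covering map, exactly**: `chart Φ a (π z) = z - Φ(n)` with
`n = boxIndex Φ a z ∈ ℤ^ι` (coordinatewise, `toIcoMod a y = y - toIcoDiv a y`).
[cite: HuybrechtsCG2005, §2.1] -/
theorem chart_cover (a : ι → ℝ) (z : E) :
    chart Φ a (cover Φ z) = z - latticeVec Φ (boxIndex Φ a z) := by
  rw [chart_apply, latticeVec]
  have key : (fun i ↦ (AddCircle.equivIco (1 : ℝ) (a i) (cover Φ z i) : ℝ)) =
      Φ.symm z - fun i ↦ (boxIndex Φ a z i : ℝ) := by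
    funext i
    change toIcoMod zero_lt_one (a i) (Φ.symm z i) = Φ.symm z i - (boxIndex Φ a z i : ℝ)
    rw [← self_sub_toIcoDiv_zsmul, zsmul_eq_mul, mul_one]
    rfl
  rw [key, map_sub, ContinuousLinearEquiv.apply_symm_apply]

/-- The centre of the preferred chart at `π z` is a lattice translate of `z`. [folklore] -/
theorem extChartAt_cover_self {𝕜 : Type*} [NontriviallyNormedField 𝕜] [NormedSpace 𝕜 E]
    (z : E) :
    extChartAt 𝓘(𝕜, E) (cover Φ z) (cover Φ z) =
      z - latticeVec Φ (boxIndex Φ (corner Φ (cover Φ z)) z) := by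
  simp [chartAt_eq, chart_cover]

/-! ### Calculus of the covering map -/

/-- Near any point, the covering map followed by a chart is a translation: for `π z₀` in the
domain of `chart Φ a`, `chart Φ a ∘ π = (· - Φ n)` near `z₀`. [cite: HuybrechtsCG2005, §2.1] -/
theorem eventuallyEq_chart_cover {a : ι → ℝ} {z₀ : E} (h : cover Φ z₀ ∈ (chart Φ a).source) :
    (fun z ↦ chart Φ a (cover Φ z)) =ᶠ[𝓝 z₀]
      fun z ↦ z - latticeVec Φ (boxIndex Φ a z₀) := by
  rw [chart_source] at h
  exact eventuallyEq_chart_symm_trans Φ h a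

/-- **The covering map is a local `C^n`-diffeomorphism with derivative the identity**: at every
`z`, `π : E → X` (source: the model space as a manifold over itself) has manifold derivative
`id` over `𝕜 ∈ {ℝ, ℂ}`. Lange–Birkenhake (1992), Lemma 1.1.3 (a), (c).
[cite: LangeBirkenhake1992, Lemma 1.1.3] -/
theorem hasMFDerivAt_cover {𝕜 : Type*} [NontriviallyNormedField 𝕜] [NormedSpace 𝕜 E] (z : E) :
    HasMFDerivAt 𝓘(𝕜, E) 𝓘(𝕜, E) (cover Φ) z (ContinuousLinearMap.id 𝕜 E) := by
  refine ⟨(continuous_cover Φ).continuousAt, ?_⟩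
  have hfun : writtenInExtChartAt 𝓘(𝕜, E) 𝓘(𝕜, E) z (cover Φ) =
      fun w ↦ chart Φ (corner Φ (cover Φ z)) (cover Φ w) := by
    funext w
    simp [writtenInExtChartAt, chartAt_eq]
  rw [hfun, extChartAt_model_space_eq_id, PartialEquiv.refl_coe, id_eq]
  have hev := eventuallyEq_chart_cover Φ (a := corner Φ (cover Φ z)) (z₀ := z)
    (by rw [← chartAt_eq]; exact mem_chart_source E _)
  exact (((hasFDerivAt_id z).sub_const _).congr_of_eventuallyEq hev).hasFDerivWithinAt

/-- `dπ = id` (`mfderiv` form). [cite: LangeBirkenhake1992, Lemma 1.1.3] -/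
theorem mfderiv_cover {𝕜 : Type*} [NontriviallyNormedField 𝕜] [NormedSpace 𝕜 E] (z : E) :
    mfderiv 𝓘(𝕜, E) 𝓘(𝕜, E) (cover Φ) z = ContinuousLinearMap.id 𝕜 E :=
  (hasMFDerivAt_cover Φ z).mfderiv

/-- The covering map is differentiable. [folklore] -/
theorem mdifferentiable_cover {𝕜 : Type*} [NontriviallyNormedField 𝕜] [NormedSpace 𝕜 E] :
    MDifferentiable 𝓘(𝕜, E) 𝓘(𝕜, E) (cover Φ) :=
  fun z ↦ (hasMFDerivAt_cover Φ z).mdifferentiableAt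

/-- **The covering map is `C^n`** over `𝕜 ∈ {ℝ, ℂ}` for every `n` (holomorphic for `𝕜 = ℂ`):
in charts it is a translation. Lange–Birkenhake (1992), Lemma 1.1.3 (a).
[cite: LangeBirkenhake1992, Lemma 1.1.3] -/
theorem contMDiff_cover {𝕜 : Type*} [NontriviallyNormedField 𝕜] [NormedSpace 𝕜 E]
    {n : WithTop ℕ∞} : ContMDiff 𝓘(𝕜, E) 𝓘(𝕜, E) n (cover Φ) := by
  intro z
  refine contMDiffAt_iff.2 ⟨(continuous_cover Φ).continuousAt, ?_⟩
  have hfun : (extChartAt 𝓘(𝕜, E) (cover Φ z) ∘ cover Φ ∘ (extChartAt 𝓘(𝕜, E) z).symm) =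
      fun w ↦ chart Φ (corner Φ (cover Φ z)) (cover Φ w) := by
    funext w
    simp [chartAt_eq]
  rw [hfun, extChartAt_model_space_eq_id, PartialEquiv.refl_coe, id_eq]
  have hev := eventuallyEq_chart_cover Φ (a := corner Φ (cover Φ z)) (z₀ := z)
    (by rw [← chartAt_eq]; exact mem_chart_source E _)
  exact ((contDiffAt_id.sub contDiffAt_const).congr_of_eventuallyEq hev).contDiffWithinAt

/-- **The charts of a complex torus have derivative the identity at their centre** (indeed on
their whole domain: `mfderiv (chartAt x) y = tangentCoordChange y x y = id`).
[cite: LangeBirkenhake1992, Lemma 1.1.3] -/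
theorem mfderiv_extChartAt_eq_id {x y : ComplexTorus Φ} (hy : y ∈ (chartAt E x).source) :
    mfderiv 𝓘(ℝ, E) 𝓘(ℝ, E) (extChartAt 𝓘(ℝ, E) x) y = ContinuousLinearMap.id ℝ E := by
  rw [extChartAt_coe, modelWithCornersSelf_coe, Function.id_comp,
    mfderiv_chartAt_eq_tangentCoordChange (I := 𝓘(ℝ, E)) hy,
    tangentCoordChange_eq_id Φ ⟨mem_chart_source E y, hy⟩]

/-! ### Forms on the torus as periodic forms on `E` -/

section Forms

variable {F : Type*} [NormedAddCommGroup F] [NormedSpace ℝ F] {k : ℕ}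

/-- **The lift of a form to the universal cover**: the field `z ↦ α (π z)` on `E` (the tangent
spaces of `X` being `E` canonically); it is the pull-back `π^* α` (`liftForm_eq_pullback`) and
it is `Φ(ℤ^ι)`-periodic (`liftForm_add_latticeVec`). Lange–Birkenhake (1992), §1.1.4 (forms on
`X = V/Λ` as `Λ`-periodic forms on `V`). [cite: LangeBirkenhake1992, §1.1.4] -/
def liftForm (α : MForm 𝓘(ℝ, E) (ComplexTorus Φ) F k) : E → E [⋀^Fin k]→L[ℝ] F :=
  fun z ↦ α (cover Φ z)

/-- Unfolding of `liftForm`. [folklore] -/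
@[simp] theorem liftForm_apply (α : MForm 𝓘(ℝ, E) (ComplexTorus Φ) F k) (z : E) :
    liftForm Φ α z = α (cover Φ z) :=
  rfl

/-- The lift is the pull-back along the covering map (whose derivative is the identity).
[cite: LangeBirkenhake1992, §1.1.4] -/
theorem liftForm_eq_pullback (α : MForm 𝓘(ℝ, E) (ComplexTorus Φ) F k) :
    (α.pullback 𝓘(ℝ, E) (cover Φ) : MForm 𝓘(ℝ, E) E F k) = liftForm Φ α := by
  funext z
  change (α (cover Φ z)).compContinuousLinearMap (mfderiv 𝓘(ℝ, E) 𝓘(ℝ, E) (cover Φ) z) = _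
  rw [mfderiv_cover]
  ext v
  rfl

/-- Values of a form at equal points agree as elements of `E [⋀^Fin k]→L[ℝ] F` (transport
across the dependent type `TangentSpace`). [folklore] -/
theorem apply_congr (α : MForm 𝓘(ℝ, E) (ComplexTorus Φ) F k) {x y : ComplexTorus Φ} (h : x = y) :
    (α x : E [⋀^Fin k]→L[ℝ] F) = α y := by
  subst h
  rfl

/-- **The lift is lattice periodic.** [cite: LangeBirkenhake1992, §1.1.4] -/
@[simp] theorem liftForm_add_latticeVec (α : MForm 𝓘(ℝ, E) (ComplexTorus Φ) F k) (z : E)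
    (n : ι → ℤ) : liftForm Φ α (z + latticeVec Φ n) = liftForm Φ α z :=
  apply_congr Φ α (cover_add_latticeVec Φ z n)

/-- `liftForm α (z - Φ n) = liftForm α z`. [folklore] -/
@[simp] theorem liftForm_sub_latticeVec (α : MForm 𝓘(ℝ, E) (ComplexTorus Φ) F k) (z : E)
    (n : ι → ℤ) : liftForm Φ α (z - latticeVec Φ n) = liftForm Φ α z :=
  apply_congr Φ α (cover_sub_latticeVec Φ z n)

/-- The lift is linear: additive. [folklore] -/
theorem liftForm_add (α β : MForm 𝓘(ℝ, E) (ComplexTorus Φ) F k) :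
    liftForm Φ (α + β) = liftForm Φ α + liftForm Φ β :=
  rfl

/-- The lift is linear: homogeneous. [folklore] -/
theorem liftForm_smul (r : ℝ) (α : MForm 𝓘(ℝ, E) (ComplexTorus Φ) F k) :
    liftForm Φ (r • α) = r • liftForm Φ α :=
  rfl

/-- The lift of the zero form. [folklore] -/
@[simp] theorem liftForm_zero : liftForm Φ (0 : MForm 𝓘(ℝ, E) (ComplexTorus Φ) F k) = 0 :=
  rfl

/-- **Invariant forms lift to constant forms.** [cite: LangeBirkenhake1992, §1.1.4] -/
@[simp] theorem liftForm_constForm (c : E [⋀^Fin k]→L[ℝ] F) :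
    liftForm Φ (constForm Φ c) = fun _ ↦ c :=
  rfl

/-- The lift is injective (the covering map is onto). [folklore] -/
theorem liftForm_injective : Function.Injective (liftForm Φ (F := F) (k := k)) := by
  intro α β h
  funext x
  obtain ⟨z, rfl⟩ := cover_surjective Φ x
  exact congrFun h z

/-- **Every chart representative of a form on the torus is its lift**: for every `x₀`,
`α.inChart x₀ = liftForm Φ α` as functions on all of `E` (the inverse extended chart is `π`,
with derivative the identity). [cite: LangeBirkenhake1992, §1.1.4] -/
theorem inChart_eq_liftForm (α : MForm 𝓘(ℝ, E) (ComplexTorus Φ) F k) (x₀ : ComplexTorus Φ) :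
    α.inChart x₀ = liftForm Φ α := by
  funext y
  rw [MForm.inChart, ModelWithCorners.Boundaryless.range_eq_univ, mfderivWithin_univ,
    extChartAt_symm_eq_cover, mfderiv_cover]
  ext v
  rfl

/-- **A form on the torus is smooth iff its lift is `C^∞` on `E`.** (Forward: the chart-wise
condition gives smoothness of the lift at every chart centre, i.e. at a lattice translate of
every point, and the lift is periodic.) [cite: LangeBirkenhake1992, §1.1.4] -/
theorem isSmoothForm_iff_contDiff_liftForm (α : MForm 𝓘(ℝ, E) (ComplexTorus Φ) F k) :
    IsSmoothForm α ↔ ContDiff ℝ ∞ (liftForm Φ α) := by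
  constructor
  · intro h
    refine contDiff_iff_contDiffAt.2 fun z ↦ ?_
    have hz := h (cover Φ z)
    rw [inChart_eq_liftForm, ModelWithCorners.Boundaryless.range_eq_univ, contDiffWithinAt_univ,
      extChartAt_cover_self] at hz
    -- transport along the lattice translation
    set n₀ := boxIndex Φ (corner Φ (cover Φ z)) z
    have hcomp : ContDiffAt ℝ ∞ ((liftForm Φ α) ∘ fun w ↦ w - latticeVec Φ n₀) z :=
      hz.comp z (contDiffAt_id.sub contDiffAt_const)
    have heq : ((liftForm Φ α) ∘ fun w ↦ w - latticeVec Φ n₀) = liftForm Φ α := by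
      funext w
      exact liftForm_sub_latticeVec Φ α w n₀
    rwa [heq] at hcomp
  · intro h x₀
    rw [inChart_eq_liftForm]
    exact h.contDiffAt.contDiffWithinAt

/-- **The exterior derivative lifts to Mathlib's `extDeriv`, unconditionally**:
`liftForm (dα) = extDeriv (liftForm α)` for EVERY form `α` on the torus (both sides are computed
by the same `fderiv` of the periodic lift; no smoothness is needed). Lange–Birkenhake (1992),
§1.1.4 (`π^*` commutes with `d`). [cite: LangeBirkenhake1992, §1.1.4] -/
theorem liftForm_mextDeriv (α : MForm 𝓘(ℝ, E) (ComplexTorus Φ) F k) :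
    liftForm Φ (mextDeriv α) = extDeriv (liftForm Φ α) := by
  funext z
  simp only [liftForm_apply, mextDeriv]
  rw [inChart_eq_liftForm, ModelWithCorners.Boundaryless.range_eq_univ, extDerivWithin_univ,
    mfderiv_extChartAt_eq_id Φ (mem_chart_source E _), extChartAt_cover_self]
  -- `extDeriv` of the periodic lift is periodic
  have hper : extDeriv (liftForm Φ α) (z - latticeVec Φ (boxIndex Φ (corner Φ (cover Φ z)) z)) =
      extDeriv (liftForm Φ α) z := by
    have hf : liftForm Φ α = fun w ↦ liftForm Φ α (w + (-latticeVec Φ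
        (boxIndex Φ (corner Φ (cover Φ z)) z))) := by
      funext w
      rw [← sub_eq_add_neg, liftForm_sub_latticeVec]
    conv_rhs => rw [hf]
    simp only [extDeriv, fderiv_comp_add_right, sub_eq_add_neg]
  rw [hper]
  ext v
  rfl

/-- A form on the torus is closed iff its lift is (`extDeriv (liftForm α) = 0`). [cite: LangeBirkenhake1992, §1.1.4] -/
theorem isClosedForm_iff_extDeriv_liftForm (α : MForm 𝓘(ℝ, E) (ComplexTorus Φ) F k) :
    IsClosedForm α ↔ extDeriv (liftForm Φ α) = 0 := by
  rw [IsClosedForm, ← liftForm_mextDeriv, ← liftForm_zero Φ (F := F) (k := k + 1)]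
  exact ⟨fun h ↦ by rw [h], fun h ↦ liftForm_injective Φ h⟩

/-- **Descent of a periodic field to the torus**: the form `x ↦ θ (φₓ x)` (value of `θ` at the
canonical lift of `x`, the centre of the preferred chart); for lattice-periodic `θ` this inverts
`liftForm` (`liftForm_descendForm`, `descendForm_liftForm`). Lange–Birkenhake (1992), §1.1.4.
[cite: LangeBirkenhake1992, §1.1.4] -/
def descendForm (θ : E → E [⋀^Fin k]→L[ℝ] F) : MForm 𝓘(ℝ, E) (ComplexTorus Φ) F k :=
  fun x ↦ θ (extChartAt 𝓘(ℝ, E) x x)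

/-- Unfolding of `descendForm`. [folklore] -/
theorem descendForm_apply (θ : E → E [⋀^Fin k]→L[ℝ] F) (x : ComplexTorus Φ) :
    descendForm Φ θ x = θ (extChartAt 𝓘(ℝ, E) x x) :=
  rfl

/-- **Lifting a descended periodic field gives it back.** [cite: LangeBirkenhake1992, §1.1.4] -/
theorem liftForm_descendForm {θ : E → E [⋀^Fin k]→L[ℝ] F}
    (hθ : ∀ (z : E) (n : ι → ℤ), θ (z + latticeVec Φ n) = θ z) :
    liftForm Φ (descendForm Φ θ) = θ := by
  funext z
  rw [liftForm_apply, descendForm_apply, extChartAt_cover_self]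
  have h := hθ (z - latticeVec Φ (boxIndex Φ (corner Φ (cover Φ z)) z))
    (boxIndex Φ (corner Φ (cover Φ z)) z)
  rw [sub_add_cancel] at h
  exact h.symm

/-- **Descending the lift of a form gives it back.** [cite: LangeBirkenhake1992, §1.1.4] -/
theorem descendForm_liftForm (α : MForm 𝓘(ℝ, E) (ComplexTorus Φ) F k) :
    descendForm Φ (liftForm Φ α) = α := by
  funext x
  rw [descendForm_apply, liftForm_apply, cover_extChartAt_self]

end Forms

end ComplexTorus

end Literature.Geometry.Kaehler
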